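import Mathlib
import Literature.NumberTheory.LFunctions.Zhang2022.Section8aStatements
import Literature.NumberTheory.LFunctions.Zhang2022.Section3Lemma33
import Literature.NumberTheory.LFunctions.Zhang2022.Section7Eq75Majorants
import Literature.NumberTheory.LFunctions.Zhang2022.Section13MeanSquareShort
import HarnessLib

/-!
# Zhang (2022) §8 p. 43 / §7 (7.5): PUBLIC fourth moments over a character family of the short
# Dirichlet polynomials `K(w,ψ)`, `K(w,ψ̄)`, `N(w,ψ)`, `N(w,ψ̄)` and of the `E₁`-term of Lemma 6.1,
# uniformly on the strip `|Re w − ½| ≤ 2α`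

Topic `Literature/NumberTheory/LFunctions/Zhang2022` (Landau–Siegel audit tree; verdict-neutral).
Y. Zhang, *Discrete mean estimates and the Landau–Siegel zero*, arXiv:2211.02515v1 (2022)
[Zhang2022LandauSiegel] — **an unrefereed manuscript under adjudication; nothing here asserts or
denies its Theorems 1–2.** ZHANG-L lane, LIB-B shape adapter: helper (H3) under the leaf
`Typed.Section15A.Eq15_6`, node §15.u008 (β) `Typed.Section15A.Step15_u008beta` (the Hölder step
`Σ_{Ψ₁}|L₂·B·K̄| ≤ (Σ|B|²)^{1/2}(Σ|L₂|⁴)^{1/4}(Σ|K̄|⁴)^{1/4}` needs family FOURTH moments of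
`K(1−s−β₃,ψ̄)` and of `L(s+β₂,ψ)` on `𝔍(−α)`), and for every other "Cauchy's inequality, Lemma 6.1 and
Lemma 3.3" step of §§8, 13, 15–17.

The tree's `Section8aFourthMoment` proves these fourth moments PRIVATELY and only on the two lines
`Re w = ½ ± α` (for `Z22:§8.u013`). This file re-derives them as PUBLIC theorems, for ANY finite family
`T` of members of `Ψ` and uniformly on the closed strip `|Re w − ½| ≤ 2α` (the weight
`n^{−2σ} ≤ e^{8π}n⁻¹` for `n ≤ P²`, `Typed.Section13.rpow_le_exp_eight_pi_mul_inv`):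

* `sum_norm_psiPoly_pow_four_le` — the engine (public twin of the private `fourth_moment_le`): for a
  `ψ`-twisted polynomial of length `N` with `(N−1)² ≤ ⌊P²⌋`, `|a(n)| ≤ B` and a weight bound
  `k^{−2σ} ≤ E/k` on `k ≤ P²`: `Σ_{ψ∈T} |Σ_{1≤n<N} a(n)ψ(n)n^{−w}|⁴ ≤ C₃₃P²·E·max(B,0)⁴·majorantConst(4,4)·(log⌊P²⌋)⁴`
  (square the polynomial — `Section7Eq75.sq_dirPoly_eq` — then Lemma 3.3 (ii) `Skeleton.lemma33b_sum_le`
  and `Σ_{m≤P²}τ₂(m)²/m ≪ (log P²)⁴`); `sum_norm_psiBarPoly_pow_four_le` — the `ψ̄`-twisted form;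
* `sum_norm_Kchar_pow_four_le`, `sum_norm_KcharBar_pow_four_le`, `sum_norm_Nchar_pow_four_le`,
  `sum_norm_NcharBar_pow_four_le` — `≤ C·P²·𝓛³⁶` on the strip, all large `D`, any `T`;
* `sum_E1main_pow_four_le` — `Σ_{ψ∈T} E₁(u,ψ)⁴ ≤ C·P²·𝓛³⁶` on the strip (Hölder in `v`, the family sum
  taken inside the integral, the engine pointwise in `v`).

Theorems only; no definitions, no new named facts; axioms standard. The `L`-function fourth moment
built on these is in the companion `Section8aFamilyFourthMomentsL`.

## References

* Y. Zhang, arXiv:2211.02515v1 (2022), §8 p. 43 (tex L2244–2247); §7 (7.5) p. 35; §6 Lemma 6.1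
  p. 30; §3 Lemma 3.3 p. 14. [cite: Zhang2022LandauSiegel, §8 p.43]
-/

noncomputable section

open Complex Real ComplexConjugate Filter MeasureTheory

namespace Literature.NumberTheory.LFunctions.Zhang2022.FourthMoments

open Skeleton MeanSquareMajorant Section7Eq75

/-! ## A. Sizes -/

/-- `𝓛 = log D → ∞`. [cite: Zhang2022LandauSiegel, §2 (2.1)] -/
private theorem tendsto_ell : Tendsto (fun D : ℕ => ell D) atTop atTop :=
  Real.tendsto_log_atTop.comp tendsto_natCast_atTop_atTop

/-- For `𝓛 ≥ 3`: `2T² ≤ P`, `T³ ≤ P` and `2 ≤ ⌊P²⌋` (`T = exp 𝓛^{1.1}`, `P = exp 𝓛⁹`).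
[cite: Zhang2022LandauSiegel, §2 (2.6); §6 p.30] -/
theorem sizes_of_three_le {D : ℕ} (hL : 3 ≤ ell D) :
    2 * bigT D ^ 2 ≤ bigP D ∧ bigT D ^ 3 ≤ bigP D ∧ 2 ≤ ⌊bigP D ^ 2⌋₊ := by
  have hL1 : 1 ≤ ell D := by linarith
  have h11 : ell D ^ (1.1 : ℝ) ≤ ell D ^ 2 := by
    have := Real.rpow_le_rpow_of_exponent_le hL1 (by norm_num : (1.1 : ℝ) ≤ 2)
    rwa [Real.rpow_two] at this
  have h9 : ell D ^ 9 = ell D ^ 2 * ell D ^ 7 := by ring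
  have h7 : (3 : ℝ) ^ 7 ≤ ell D ^ 7 := pow_le_pow_left₀ (by norm_num) hL 7
  have h2sq : (9 : ℝ) ≤ ell D ^ 2 := by nlinarith
  have hkey : Real.log 2 + 2 * ell D ^ (1.1 : ℝ) ≤ ell D ^ 9 := by
    rw [h9]; nlinarith [Real.log_two_lt_d9]
  have hkey' : 3 * ell D ^ (1.1 : ℝ) ≤ ell D ^ 9 := by
    rw [h9]; nlinarith
  have hP : 2 * bigT D ^ 2 ≤ bigP D := by
    rw [bigT, bigP, ← Real.exp_nat_mul]
    have : (2 : ℝ) * Real.exp ((2 : ℕ) * ell D ^ (1.1 : ℝ)) =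
        Real.exp (Real.log 2 + 2 * ell D ^ (1.1 : ℝ)) := by
      rw [Real.exp_add, Real.exp_log two_pos]; push_cast; ring
    rw [this]
    exact Real.exp_le_exp.mpr hkey
  have hP2 : bigT D ^ 3 ≤ bigP D := by
    rw [bigT, bigP, ← Real.exp_nat_mul]
    push_cast
    exact Real.exp_le_exp.mpr hkey'
  refine ⟨hP, hP2, ?_⟩
  have h2P : (2 : ℝ) ≤ bigP D ^ 2 := by
    have h1 : (1 : ℝ) ≤ bigT D ^ 2 := one_le_pow₀ (Real.one_lt_exp_iff.2 (by positivity)).le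
    have hP0 : 0 ≤ bigP D := (Real.exp_pos _).le
    nlinarith
  exact Nat.le_floor (by exact_mod_cast h2P)

/-- **Sizes for all large `D`**: `𝓛 ≥ 3`, `2T² ≤ P`, `T³ ≤ P`, `2 ≤ ⌊P²⌋`, `2P₄ ≤ P`.
[cite: Zhang2022LandauSiegel, §2 (2.6), (2.8); §6 Lemma 6.1 p.30] -/
theorem eventually_sizes : ∃ D₀ : ℕ, ∀ D : ℕ, D₀ ≤ D →
    3 ≤ ell D ∧ 2 * bigT D ^ 2 ≤ bigP D ∧ bigT D ^ 3 ≤ bigP D ∧ 2 ≤ ⌊bigP D ^ 2⌋₊ ∧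
      2 * P4 D ≤ bigP D := by
  obtain ⟨D₀, h⟩ := Filter.eventually_atTop.mp (tendsto_ell.eventually (eventually_ge_atTop (3 : ℝ)))
  obtain ⟨D₁, h₁⟩ := Typed.Section13.eventually_two_P4_add_one_le
  refine ⟨max D₀ D₁, fun D hD => ?_⟩
  have hL : 3 ≤ ell D := h D (le_trans (le_max_left _ _) hD)
  have hP4 := h₁ D (le_trans (le_max_right _ _) hD)
  obtain ⟨h2, h3, h4⟩ := sizes_of_three_le hL
  exact ⟨hL, h2, h3, h4, by linarith⟩

/-- `2α = 2π𝓛⁻⁹ ≤ 1/4` for `𝓛 ≥ 3`. [cite: Zhang2022LandauSiegel, §2 (2.10)] -/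
theorem two_alpha_le_quarter {D : ℕ} (hL : 3 ≤ ell D) : 2 * alpha D ≤ 1 / 4 := by
  have hα : alpha D = π / ell D ^ 9 := by rw [alpha, bigP, Real.log_exp]
  have hL9 : (3 : ℝ) ^ 9 ≤ ell D ^ 9 := pow_le_pow_left₀ (by norm_num) hL 9
  rw [hα, mul_div_assoc', div_le_iff₀ (by positivity)]
  nlinarith [Real.pi_lt_four]

/-- `(⌈y⌉ − 1)² ≤ ⌊P²⌋` when `0 ≤ y ≤ P`. [cite: Zhang2022LandauSiegel, §7 (7.5) p.35] -/
theorem ceil_sub_one_sq_le {D : ℕ} {y : ℝ} (hy0 : 0 ≤ y) (hy : y ≤ bigP D) :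
    (⌈y⌉₊ - 1) * (⌈y⌉₊ - 1) ≤ ⌊bigP D ^ 2⌋₊ := by
  have h1 : ((⌈y⌉₊ - 1 : ℕ) : ℝ) ≤ y := cast_ceil_sub_one_le hy0
  have h0 : 0 ≤ ((⌈y⌉₊ - 1 : ℕ) : ℝ) := Nat.cast_nonneg _
  apply Nat.le_floor
  push_cast
  calc ((⌈y⌉₊ - 1 : ℕ) : ℝ) * ((⌈y⌉₊ - 1 : ℕ) : ℝ) ≤ y * y := mul_le_mul h1 h1 h0 hy0
    _ ≤ bigP D * bigP D := mul_le_mul hy hy hy0 (Real.exp_pos _).le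
    _ = bigP D ^ 2 := (sq _).symm

/-- `(log ⌊P²⌋)⁴ ≤ 16𝓛³⁶` (`log P² = 2𝓛⁹`; needs `2 ≤ ⌊P²⌋`). [cite: Zhang2022LandauSiegel, §2 (2.6)] -/
theorem log_floor_sq_pow_four_le {D : ℕ} (hK : 2 ≤ ⌊bigP D ^ 2⌋₊) :
    Real.log (⌊bigP D ^ 2⌋₊ : ℝ) ^ 4 ≤ 16 * ell D ^ 36 := by
  have hK0 : (0 : ℝ) < ⌊bigP D ^ 2⌋₊ := by exact_mod_cast (by omega : 0 < ⌊bigP D ^ 2⌋₊)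
  have h1 : Real.log (⌊bigP D ^ 2⌋₊ : ℝ) ≤ 2 * ell D ^ 9 := by
    calc Real.log (⌊bigP D ^ 2⌋₊ : ℝ) ≤ Real.log (bigP D ^ 2) :=
          Real.log_le_log hK0 (Nat.floor_le (by positivity))
      _ = 2 * ell D ^ 9 := by rw [bigP, ← Real.exp_nat_mul, Real.log_exp]; push_cast; ring
  have h0 : 0 ≤ Real.log (⌊bigP D ^ 2⌋₊ : ℝ) :=
    Real.log_nonneg (by exact_mod_cast (by omega : 1 ≤ ⌊bigP D ^ 2⌋₊))
  calc Real.log (⌊bigP D ^ 2⌋₊ : ℝ) ^ 4 ≤ (2 * ell D ^ 9) ^ 4 := pow_le_pow_left₀ h0 h1 4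
    _ = 16 * ell D ^ 36 := by ring

/-- **The strip weight**: for `𝓛 ≥ 1`, `|Re w − ½| ≤ 2α` and `1 ≤ k ≤ ⌊P²⌋`,
`k^{−2Re w} ≤ e^{8π}·k⁻¹` (`k^{1−2σ} ≤ (P²)^{4α} = e^{8π}`, `α log P = π`).
[cite: Zhang2022LandauSiegel, §2 (2.10); §8 p.43] -/
theorem weight_strip {D : ℕ} (hL : 1 ≤ ell D) {w : ℂ} (hw : |w.re - 1 / 2| ≤ 2 * alpha D)
    (k : ℕ) (hk : k ∈ Finset.Icc 1 ⌊bigP D ^ 2⌋₊) :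
    (k : ℝ) ^ (-2 * w.re) ≤ Real.exp (8 * π) * (k : ℝ)⁻¹ := by
  obtain ⟨hk1, hkK⟩ := Finset.mem_Icc.mp hk
  have he : |-2 * w.re + 1| ≤ 4 * alpha D := by
    have : -2 * w.re + 1 = -2 * (w.re - 1 / 2) := by ring
    rw [this, abs_mul, abs_neg, abs_two]
    linarith
  have hkP : (k : ℝ) ≤ bigP D ^ 2 := le_trans (by exact_mod_cast hkK) (Nat.floor_le (by positivity))
  exact Typed.Section13.rpow_le_exp_eight_pi_mul_inv hL he hk1 hkP

/-- For natural-number bases: `conj((n:ℂ)^w) = (n:ℂ)^(conj w)`. [folklore] -/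
private theorem conj_natCast_cpow (n : ℕ) (s : ℂ) : conj ((n : ℂ) ^ s) = (n : ℂ) ^ conj s := by
  have h := Complex.conj_cpow (n : ℂ) (conj s) (by rw [Complex.natCast_arg]; exact Real.pi_ne_zero.symm)
  rw [Complex.conj_conj, Complex.conj_natCast] at h
  exact h.symm

/-! ## B. The engine: the fourth moment of a truncated `ψ`-polynomial over a finite family -/

/-- **`Σ_{ψ∈T} |Σ_{1≤n<N} a(n)ψ(n)n^{−w}|⁴ ≤ C₃₃·P²·E·max(B,0)⁴·majorantConst(4,4)·(log⌊P²⌋)⁴`**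
for any finite family `T` of members of `Ψ`, `(N−1)² ≤ ⌊P²⌋`, `2 ≤ ⌊P²⌋`, `|a(n)| ≤ B` and a weight
bound `k^{−2Re w} ≤ E·k⁻¹` on `1 ≤ k ≤ ⌊P²⌋`: the square is a `ψ`-polynomial of length `≤ P²` with
coefficients `|a′⋆a′| ≤ B²τ₂` (`Section7Eq75.sq_dirPoly_eq`), then Lemma 3.3 (ii)
(`Skeleton.lemma33b_sum_le`) and `Σ_{m≤P²}τ₂(m)²/m ≪ (log P²)⁴`
(`MeanSquareMajorant.sum_norm_seqConv_sq_div_le`) — the (7.5) chain; the public twin of the private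
`Section8aStatements.fourth_moment_le`. [cite: Zhang2022LandauSiegel, §7 (7.5) p.35, tex L1904; §8 p.43] -/
theorem sum_norm_psiPoly_pow_four_le {D : ℕ} (T : Finset (Chr D)) {N : ℕ}
    (hN : (N - 1) * (N - 1) ≤ ⌊bigP D ^ 2⌋₊) (h2 : 2 ≤ ⌊bigP D ^ 2⌋₊)
    (a : ℕ → ℂ) {B : ℝ} (ha : ∀ n, ‖a n‖ ≤ B) (w : ℂ) {E : ℝ}
    (hE : ∀ k ∈ Finset.Icc 1 ⌊bigP D ^ 2⌋₊, (k : ℝ) ^ (-2 * w.re) ≤ E * (k : ℝ)⁻¹) :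
    ∑ x ∈ T, ‖∑ n ∈ Finset.Ico 1 N, a n * x.ψ (n : ZMod x.p) * (n : ℂ) ^ (-w)‖ ^ 4 ≤
      (2 + 2 * (3 + (Real.log 2 ^ 68)⁻¹) ^ 2) * bigP D ^ 2 *
        (E * ((max B 0) ^ 4 * (majorantConst 4 4 * Real.log (⌊bigP D ^ 2⌋₊ : ℝ) ^ 4))) := by
  classical
  set K := ⌊bigP D ^ 2⌋₊ with hKdef
  set a' : ℕ → ℂ := fun n => if n < N then a n else 0 with ha'def
  have ha' : ∀ n, n ≠ 0 → ‖a' n‖ ≤ max B 0 := fun n _ => norm_truncSeq_le ha n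
  have hsq : ∀ x : Chr D,
      (∑ n ∈ Finset.Ico 1 N, a n * x.ψ (n : ZMod x.p) * (n : ℂ) ^ (-w)) ^ 2 =
        ∑ k ∈ Finset.Icc 1 K, seqConv a' a' k * x.ψ (k : ZMod x.p) * (k : ℂ) ^ (-w) := by
    intro x
    have hθ0 : x.ψ ((0 : ℕ) : ZMod x.p) = 0 := by
      rw [Nat.cast_zero]; exact MulChar.map_zero _
    have hθ : ∀ m n : ℕ, x.ψ ((m * n : ℕ) : ZMod x.p) = x.ψ (m : ZMod x.p) * x.ψ (n : ZMod x.p) := by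
      intro m n; rw [Nat.cast_mul, map_mul]
    rw [← sq_dirPoly_eq N K hN a (fun n => x.ψ (n : ZMod x.p)) hθ0 hθ w]
    congr 1
    rcases Nat.eq_zero_or_pos N with hN0 | hNpos
    · subst hN0; simp
    · rw [Finset.range_eq_Ico, Finset.sum_eq_sum_Ico_succ_bot hNpos, hθ0]; simp
  have hC : (0 : ℝ) ≤ (2 + 2 * (3 + (Real.log 2 ^ 68)⁻¹) ^ 2) * bigP D ^ 2 := by positivity
  calc ∑ x ∈ T, ‖∑ n ∈ Finset.Ico 1 N, a n * x.ψ (n : ZMod x.p) * (n : ℂ) ^ (-w)‖ ^ 4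
      = ∑ x ∈ T, ‖∑ k ∈ Finset.Icc 1 K, seqConv a' a' k * x.ψ (k : ZMod x.p) * (k : ℂ) ^ (-w)‖ ^ 2 := by
        refine Finset.sum_congr rfl fun x _ => ?_
        rw [← hsq x, norm_pow]; ring
    _ ≤ (2 + 2 * (3 + (Real.log 2 ^ 68)⁻¹) ^ 2) * bigP D ^ 2 *
          ∑ k ∈ Finset.Icc 1 K, ‖seqConv a' a' k‖ ^ 2 * (k : ℝ) ^ (-2 * w.re) :=
        lemma33b_sum_le T w (seqConv a' a')
    _ ≤ (2 + 2 * (3 + (Real.log 2 ^ 68)⁻¹) ^ 2) * bigP D ^ 2 *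
          ∑ k ∈ Finset.Icc 1 K, ‖seqConv a' a' k‖ ^ 2 * (E * (k : ℝ)⁻¹) := by
        apply mul_le_mul_of_nonneg_left _ hC
        exact Finset.sum_le_sum fun k hk => mul_le_mul_of_nonneg_left (hE k hk) (sq_nonneg _)
    _ = (2 + 2 * (3 + (Real.log 2 ^ 68)⁻¹) ^ 2) * bigP D ^ 2 *
          (E * ∑ k ∈ Finset.Icc 1 K, ‖seqConv a' a' k‖ ^ 2 / k) := by
        congr 1
        rw [Finset.mul_sum]
        exact Finset.sum_congr rfl fun k _ => by rw [div_eq_mul_inv]; ring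
    _ ≤ (2 + 2 * (3 + (Real.log 2 ^ 68)⁻¹) ^ 2) * bigP D ^ 2 *
          (E * ((max B 0) ^ 4 * (majorantConst 4 4 * Real.log (K : ℝ) ^ 4))) := by
        apply mul_le_mul_of_nonneg_left _ hC
        have hE0 : 0 ≤ E := by
          have h1 : 1 ∈ Finset.Icc 1 K := Finset.mem_Icc.mpr ⟨le_rfl, by omega⟩
          have := hE 1 h1
          simp at this
          linarith
        exact mul_le_mul_of_nonneg_left (sum_norm_seqConv_sq_div_le ha' h2) hE0

/-- **The `ψ̄`-twisted engine**: the same bound for `Σ_{ψ∈T} |Σ_{1≤n<N} a(n)ψ̄(n)n^{−w}|⁴`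
(conjugate: it is the `ψ`-twisted polynomial with coefficients `ā` at `w̄`, `Re w̄ = Re w`).
[cite: Zhang2022LandauSiegel, §7 (7.5) p.35; §8 p.43] -/
theorem sum_norm_psiBarPoly_pow_four_le {D : ℕ} (T : Finset (Chr D)) {N : ℕ}
    (hN : (N - 1) * (N - 1) ≤ ⌊bigP D ^ 2⌋₊) (h2 : 2 ≤ ⌊bigP D ^ 2⌋₊)
    (a : ℕ → ℂ) {B : ℝ} (ha : ∀ n, ‖a n‖ ≤ B) (w : ℂ) {E : ℝ}
    (hE : ∀ k ∈ Finset.Icc 1 ⌊bigP D ^ 2⌋₊, (k : ℝ) ^ (-2 * w.re) ≤ E * (k : ℝ)⁻¹) :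
    ∑ x ∈ T, ‖∑ n ∈ Finset.Ico 1 N, a n * conj (x.ψ (n : ZMod x.p)) * (n : ℂ) ^ (-w)‖ ^ 4 ≤
      (2 + 2 * (3 + (Real.log 2 ^ 68)⁻¹) ^ 2) * bigP D ^ 2 *
        (E * ((max B 0) ^ 4 * (majorantConst 4 4 * Real.log (⌊bigP D ^ 2⌋₊ : ℝ) ^ 4))) := by
  have hkey : ∀ x : Chr D,
      ‖∑ n ∈ Finset.Ico 1 N, a n * conj (x.ψ (n : ZMod x.p)) * (n : ℂ) ^ (-w)‖ =
        ‖∑ n ∈ Finset.Ico 1 N, conj (a n) * x.ψ (n : ZMod x.p) * (n : ℂ) ^ (-conj w)‖ := by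
    intro x
    rw [← Complex.norm_conj, map_sum]
    congr 1
    refine Finset.sum_congr rfl fun n _ => ?_
    rw [map_mul, map_mul, Complex.conj_conj, conj_natCast_cpow, map_neg]
  simp_rw [hkey]
  exact sum_norm_psiPoly_pow_four_le T hN h2 (fun n => conj (a n)) (B := B)
    (fun n => by rw [Complex.norm_conj]; exact ha n) (conj w)
    (fun k hk => by rw [Complex.conj_re]; exact hE k hk)

/-! ## C. The instances `K`, `K̄`, `N`, `N̄` on the strip -/

/-- `K(w,ψ) = Σ_{n<2P₄} g*(P₄/n)ψ(n)n^{−w}` (coefficient first). [cite: Zhang2022LandauSiegel, §6 Lemma 6.1 p.30] -/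
private theorem Kchar_eq (D : ℕ) (x : Chr D) (w : ℂ) :
    Kchar D (psiFn x) w = ∑ n ∈ Finset.Ico 1 ⌈2 * P4 D⌉₊,
      (gstar D (P4 D / n) : ℂ) * x.ψ (n : ZMod x.p) * (n : ℂ) ^ (-w) := by
  rw [Kchar]
  exact Finset.sum_congr rfl fun n _ => by simp only [psiFn]; ring

/-- `N(w,ψ) = Σ_{n<2T²} g*(T²/n)ψ(n)n^{−w}` (coefficient first). [cite: Zhang2022LandauSiegel, §6 Lemma 6.1 p.30] -/
private theorem Nchar_eq (D : ℕ) (x : Chr D) (w : ℂ) :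
    Nchar D (psiFn x) w = ∑ n ∈ Finset.Ico 1 ⌈2 * bigT D ^ 2⌉₊,
      (gstar D (bigT D ^ 2 / n) : ℂ) * x.ψ (n : ZMod x.p) * (n : ℂ) ^ (-w) := by
  rw [Nchar]
  exact Finset.sum_congr rfl fun n _ => by simp only [psiFn]; ring

/-- `|K(w,ψ̄)| = |K(w̄,ψ)|` (conjugation; the weights `g*` are real).
[cite: Zhang2022LandauSiegel, §6 Lemma 6.1 p.30; §13 (13.3)] -/
theorem norm_Kchar_bar (D : ℕ) (x : Chr D) (w : ℂ) :
    ‖Kchar D (psiBarFn x) w‖ = ‖Kchar D (psiFn x) (conj w)‖ := by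
  rw [← Complex.norm_conj (Kchar D (psiBarFn x) w)]
  congr 1
  rw [Kchar, Kchar, map_sum]
  refine Finset.sum_congr rfl fun n _ => ?_
  rw [map_mul, map_mul, conj_natCast_cpow, map_neg, Complex.conj_ofReal]
  simp only [psiBarFn, psiFn, Complex.conj_conj]

/-- `|N(w,ψ̄)| = |N(w̄,ψ)|` (conjugation; the weights `g*` are real).
[cite: Zhang2022LandauSiegel, §6 Lemma 6.1 p.30] -/
theorem norm_Nchar_bar (D : ℕ) (x : Chr D) (w : ℂ) :
    ‖Nchar D (psiBarFn x) w‖ = ‖Nchar D (psiFn x) (conj w)‖ := by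
  rw [← Complex.norm_conj (Nchar D (psiBarFn x) w)]
  congr 1
  rw [Nchar, Nchar, map_sum]
  refine Finset.sum_congr rfl fun n _ => ?_
  rw [map_mul, map_mul, conj_natCast_cpow, map_neg, Complex.conj_ofReal]
  simp only [psiBarFn, psiFn, Complex.conj_conj]

/-- **`Σ_{ψ∈T} |K(w,ψ)|⁴ ≤ C·P²·𝓛³⁶` on the strip `|Re w − ½| ≤ 2α`** (any finite `T ⊆ Ψ`, all large
`D`): length `(2P₄)² ≤ P²`, weights `|g*| ≤ 1`, `n^{−2σ} ≤ e^{8π}n⁻¹`.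
[cite: Zhang2022LandauSiegel, §8 p.43, tex L2244–2247; §6 Lemma 6.1 p.30] -/
theorem sum_norm_Kchar_pow_four_le : ∃ C : ℝ, ∃ D₀ : ℕ, ∀ D : ℕ, D₀ ≤ D →
    ∀ (T : Finset (Chr D)) (w : ℂ), |w.re - 1 / 2| ≤ 2 * alpha D →
      ∑ x ∈ T, ‖Kchar D (psiFn x) w‖ ^ 4 ≤ C * bigP D ^ 2 * ell D ^ 36 := by
  obtain ⟨D₁, h₁⟩ := eventually_sizes
  refine ⟨(2 + 2 * (3 + (Real.log 2 ^ 68)⁻¹) ^ 2) * (Real.exp (8 * π) * (16 * majorantConst 4 4)), D₁,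
    fun D hD T w hw => ?_⟩
  obtain ⟨hL3, -, -, hK2, hP4'⟩ := h₁ D hD
  have hL0 : 0 < ell D := by linarith
  have hL1 : 1 ≤ ell D := by linarith
  have hP4 : 0 ≤ 2 * P4 D := by
    have : 0 ≤ P4 D := by
      rw [P4, t0]
      exact mul_nonneg (div_nonneg (Real.exp_pos _).le (pow_nonneg (Real.exp_pos _).le 2))
        (pow_nonneg hL0.le 519)
    linarith
  have hmain := sum_norm_psiPoly_pow_four_le T (ceil_sub_one_sq_le hP4 hP4') hK2
    (fun n => (gstar D (P4 D / n) : ℂ)) (B := 1) (fun n => Typed.Section13.norm_gstar_le_one hL0 _)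
    w (fun k hk => weight_strip hL1 hw k hk)
  have hlog := log_floor_sq_pow_four_le hK2
  have hmc := (majorantConst_pos 4 4).le
  rw [max_eq_left zero_le_one, one_pow, one_mul] at hmain
  calc ∑ x ∈ T, ‖Kchar D (psiFn x) w‖ ^ 4
      = ∑ x ∈ T, ‖∑ n ∈ Finset.Ico 1 ⌈2 * P4 D⌉₊,
          (gstar D (P4 D / n) : ℂ) * x.ψ (n : ZMod x.p) * (n : ℂ) ^ (-w)‖ ^ 4 := by
        simp_rw [Kchar_eq]
    _ ≤ (2 + 2 * (3 + (Real.log 2 ^ 68)⁻¹) ^ 2) * bigP D ^ 2 *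
          (Real.exp (8 * π) * (majorantConst 4 4 * Real.log (⌊bigP D ^ 2⌋₊ : ℝ) ^ 4)) := hmain
    _ ≤ (2 + 2 * (3 + (Real.log 2 ^ 68)⁻¹) ^ 2) * bigP D ^ 2 *
          (Real.exp (8 * π) * (majorantConst 4 4 * (16 * ell D ^ 36))) :=
        mul_le_mul_of_nonneg_left (mul_le_mul_of_nonneg_left
          (mul_le_mul_of_nonneg_left hlog hmc) (Real.exp_pos _).le) (by positivity)
    _ = _ := by ring

/-- **`Σ_{ψ∈T} |K(w,ψ̄)|⁴ ≤ C·P²·𝓛³⁶` on the strip** (the conjugate-character `K` of (13.3)–(13.5) and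
of §15.u008's `M₁`): by `norm_Kchar_bar` and the `ψ`-version at `w̄`.
[cite: Zhang2022LandauSiegel, §8 p.43; §13 (13.3); §15 p.80] -/
theorem sum_norm_KcharBar_pow_four_le : ∃ C : ℝ, ∃ D₀ : ℕ, ∀ D : ℕ, D₀ ≤ D →
    ∀ (T : Finset (Chr D)) (w : ℂ), |w.re - 1 / 2| ≤ 2 * alpha D →
      ∑ x ∈ T, ‖Kchar D (psiBarFn x) w‖ ^ 4 ≤ C * bigP D ^ 2 * ell D ^ 36 := by
  obtain ⟨C, D₀, h⟩ := sum_norm_Kchar_pow_four_le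
  refine ⟨C, D₀, fun D hD T w hw => ?_⟩
  simp_rw [norm_Kchar_bar]
  exact h D hD T (conj w) (by rw [Complex.conj_re]; exact hw)

/-- **`Σ_{ψ∈T} |N(w,ψ)|⁴ ≤ C·P²·𝓛³⁶` on the strip `|Re w − ½| ≤ 2α`** (any finite `T ⊆ Ψ`, all large
`D`): length `(2T²)² ≤ P²`. [cite: Zhang2022LandauSiegel, §8 p.43, tex L2244–2247; §6 Lemma 6.1 p.30] -/
theorem sum_norm_Nchar_pow_four_le : ∃ C : ℝ, ∃ D₀ : ℕ, ∀ D : ℕ, D₀ ≤ D →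
    ∀ (T : Finset (Chr D)) (w : ℂ), |w.re - 1 / 2| ≤ 2 * alpha D →
      ∑ x ∈ T, ‖Nchar D (psiFn x) w‖ ^ 4 ≤ C * bigP D ^ 2 * ell D ^ 36 := by
  obtain ⟨D₁, h₁⟩ := eventually_sizes
  refine ⟨(2 + 2 * (3 + (Real.log 2 ^ 68)⁻¹) ^ 2) * (Real.exp (8 * π) * (16 * majorantConst 4 4)), D₁,
    fun D hD T w hw => ?_⟩
  obtain ⟨hL3, h2T, -, hK2, -⟩ := h₁ D hD
  have hL0 : 0 < ell D := by linarith
  have hL1 : 1 ≤ ell D := by linarith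
  have hT2 : 0 ≤ 2 * bigT D ^ 2 := by positivity
  have hmain := sum_norm_psiPoly_pow_four_le T (ceil_sub_one_sq_le hT2 h2T) hK2
    (fun n => (gstar D (bigT D ^ 2 / n) : ℂ)) (B := 1)
    (fun n => Typed.Section13.norm_gstar_le_one hL0 _) w (fun k hk => weight_strip hL1 hw k hk)
  have hlog := log_floor_sq_pow_four_le hK2
  have hmc := (majorantConst_pos 4 4).le
  rw [max_eq_left zero_le_one, one_pow, one_mul] at hmain
  calc ∑ x ∈ T, ‖Nchar D (psiFn x) w‖ ^ 4
      = ∑ x ∈ T, ‖∑ n ∈ Finset.Ico 1 ⌈2 * bigT D ^ 2⌉₊,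
          (gstar D (bigT D ^ 2 / n) : ℂ) * x.ψ (n : ZMod x.p) * (n : ℂ) ^ (-w)‖ ^ 4 := by
        simp_rw [Nchar_eq]
    _ ≤ (2 + 2 * (3 + (Real.log 2 ^ 68)⁻¹) ^ 2) * bigP D ^ 2 *
          (Real.exp (8 * π) * (majorantConst 4 4 * Real.log (⌊bigP D ^ 2⌋₊ : ℝ) ^ 4)) := hmain
    _ ≤ (2 + 2 * (3 + (Real.log 2 ^ 68)⁻¹) ^ 2) * bigP D ^ 2 *
          (Real.exp (8 * π) * (majorantConst 4 4 * (16 * ell D ^ 36))) :=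
        mul_le_mul_of_nonneg_left (mul_le_mul_of_nonneg_left
          (mul_le_mul_of_nonneg_left hlog hmc) (Real.exp_pos _).le) (by positivity)
    _ = _ := by ring

/-- **`Σ_{ψ∈T} |N(w,ψ̄)|⁴ ≤ C·P²·𝓛³⁶` on the strip** (the `N(1−s,ψ̄)` of Lemma 6.1): by
`norm_Nchar_bar` and the `ψ`-version at `w̄`. [cite: Zhang2022LandauSiegel, §8 p.43; §6 Lemma 6.1 p.30] -/
theorem sum_norm_NcharBar_pow_four_le : ∃ C : ℝ, ∃ D₀ : ℕ, ∀ D : ℕ, D₀ ≤ D →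
    ∀ (T : Finset (Chr D)) (w : ℂ), |w.re - 1 / 2| ≤ 2 * alpha D →
      ∑ x ∈ T, ‖Nchar D (psiBarFn x) w‖ ^ 4 ≤ C * bigP D ^ 2 * ell D ^ 36 := by
  obtain ⟨C, D₀, h⟩ := sum_norm_Nchar_pow_four_le
  refine ⟨C, D₀, fun D hD T w hw => ?_⟩
  simp_rw [norm_Nchar_bar]
  exact h D hD T (conj w) (by rw [Complex.conj_re]; exact hw)

/-! ## D. The error term `E₁(u,ψ)⁴` on the strip: Hölder in `v`, then the engine pointwise in `v` -/

/-- **Hölder**: `(∫_{−L}^{L} f)⁴ ≤ (2L)³ ∫_{−L}^{L} f⁴` for a continuous bounded `f ≥ 0`.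
[cite: Zhang2022LandauSiegel, §8 p.43 ("By Cauchy's inequality")] -/
theorem integral_pow_four_le {f : ℝ → ℝ} (hf : Continuous f) (h0 : ∀ v, 0 ≤ f v)
    {M : ℝ} (hM : ∀ v, f v ≤ M) {L : ℝ} (hL : 0 ≤ L) :
    (∫ v in (-L)..L, f v) ^ 4 ≤ (2 * L) ^ 3 * ∫ v in (-L)..L, f v ^ 4 := by
  have hLL : -L ≤ L := by linarith
  rw [intervalIntegral.integral_of_le hLL, intervalIntegral.integral_of_le hLL]
  set μ : Measure ℝ := volume.restrict (Set.Ioc (-L) L) with hμ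
  have hpq : (4 : ℝ).HolderConjugate (4 / 3) :=
    Real.holderConjugate_iff.mpr ⟨by norm_num, by norm_num⟩
  have hfm : MemLp f (ENNReal.ofReal 4) μ :=
    MemLp.of_bound hf.aestronglyMeasurable M
      (ae_of_all _ fun v => by rw [Real.norm_of_nonneg (h0 v)]; exact hM v)
  have hgm : MemLp (fun _ : ℝ => (1 : ℝ)) (ENNReal.ofReal (4 / 3)) μ := memLp_const 1
  have hH := integral_mul_le_Lp_mul_Lq_of_nonneg hpq (ae_of_all _ h0)
    (ae_of_all _ fun _ => zero_le_one) hfm hgm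
  have hμu : μ.real Set.univ = 2 * L := by
    rw [hμ, measureReal_restrict_apply_univ, Real.volume_real_Ioc_of_le hLL]; ring
  have hI0 : 0 ≤ ∫ v, f v ∂μ := integral_nonneg h0
  have hI4 : 0 ≤ ∫ v, f v ^ 4 ∂μ := integral_nonneg fun v => by positivity
  simp only [mul_one, Real.one_rpow, integral_const, smul_eq_mul, hμu, Real.rpow_ofNat] at hH
  have h2L : 0 ≤ 2 * L := by linarith
  calc (∫ v, f v ∂μ) ^ 4
      ≤ ((∫ v, f v ^ 4 ∂μ) ^ (1 / 4 : ℝ) * (2 * L) ^ (1 / (4 / 3) : ℝ)) ^ 4 :=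
        pow_le_pow_left₀ hI0 hH 4
    _ = (2 * L) ^ 3 * ∫ v, f v ^ 4 ∂μ := by
        rw [mul_pow, ← Real.rpow_natCast ((∫ v, f v ^ 4 ∂μ) ^ (1 / 4 : ℝ)) 4,
          ← Real.rpow_mul hI4, ← Real.rpow_natCast ((2 * L) ^ (1 / (4 / 3) : ℝ)) 4,
          ← Real.rpow_mul h2L]
        norm_num
        ring

/-- The integrand `v ↦ |Σ_{n<T³} ψ(n)n^{−(w+iv)}|·ω₁(iv)` of `E₁(w,ψ)` is continuous.
[cite: Zhang2022LandauSiegel, §6 Lemma 6.1 p.30] -/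
theorem continuous_E1integrand {D : ℕ} (x : Chr D) (w : ℂ) :
    Continuous fun v : ℝ =>
      ‖∑ n ∈ Finset.Ico 1 ⌈bigT D ^ 3⌉₊, x.ψ (n : ZMod x.p) * (n : ℂ) ^ (-(w + v * I))‖ *
        Real.exp (-(v ^ 2) / (4 * ell D ^ 30)) := by
  refine (Continuous.norm ?_).mul (by fun_prop)
  refine continuous_finsetSum _ fun n hn => ?_
  have hn0 : (n : ℂ) ≠ 0 := by
    exact_mod_cast (Nat.one_le_iff_ne_zero.mp (Finset.mem_Ico.mp hn).1)
  exact continuous_const.mul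
    ((continuous_const.add (Complex.continuous_ofReal.mul continuous_const)).neg.const_cpow
      (Or.inl hn0))

/-- A trivial bound for the integrand of `E₁`: `|Σ_{n<T³} ψ(n)n^{−(w+iv)}|·ω₁ ≤ #{n < T³}` for
`Re w ≥ 0`. [cite: Zhang2022LandauSiegel, §6 Lemma 6.1 p.30] -/
theorem E1integrand_le {D : ℕ} (x : Chr D) {w : ℂ} (hw : 0 ≤ w.re) (v : ℝ) :
    ‖∑ n ∈ Finset.Ico 1 ⌈bigT D ^ 3⌉₊, x.ψ (n : ZMod x.p) * (n : ℂ) ^ (-(w + v * I))‖ *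
        Real.exp (-(v ^ 2) / (4 * ell D ^ 30)) ≤ ((Finset.Ico 1 ⌈bigT D ^ 3⌉₊).card : ℝ) := by
  have hexp : Real.exp (-(v ^ 2) / (4 * ell D ^ 30)) ≤ 1 := by
    rw [Real.exp_le_one_iff, neg_div]
    exact neg_nonpos.mpr (by positivity)
  have hsum : ‖∑ n ∈ Finset.Ico 1 ⌈bigT D ^ 3⌉₊, x.ψ (n : ZMod x.p) * (n : ℂ) ^ (-(w + v * I))‖ ≤
      ((Finset.Ico 1 ⌈bigT D ^ 3⌉₊).card : ℝ) := by
    have h : ∀ n ∈ Finset.Ico 1 ⌈bigT D ^ 3⌉₊,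
        ‖x.ψ (n : ZMod x.p) * (n : ℂ) ^ (-(w + v * I))‖ ≤ 1 := by
      intro n hn
      have hn1 : 1 ≤ n := (Finset.mem_Ico.mp hn).1
      rw [norm_mul, Complex.norm_natCast_cpow_of_pos hn1]
      have h1 : ‖x.ψ (n : ZMod x.p)‖ ≤ 1 := x.ψ.norm_le_one _
      have h2 : (n : ℝ) ^ ((-(w + v * I)).re) ≤ 1 :=
        Real.rpow_le_one_of_one_le_of_nonpos (by exact_mod_cast hn1) (by simp; linarith)
      calc ‖x.ψ (n : ZMod x.p)‖ * (n : ℝ) ^ ((-(w + v * I)).re) ≤ 1 * 1 :=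
            mul_le_mul h1 h2 (Real.rpow_nonneg (Nat.cast_nonneg n) _) zero_le_one
        _ = 1 := one_mul 1
    calc _ ≤ ∑ n ∈ Finset.Ico 1 ⌈bigT D ^ 3⌉₊, ‖x.ψ (n : ZMod x.p) * (n : ℂ) ^ (-(w + v * I))‖ :=
          norm_sum_le _ _
      _ ≤ ∑ n ∈ Finset.Ico 1 ⌈bigT D ^ 3⌉₊, (1 : ℝ) := Finset.sum_le_sum h
      _ = _ := by simp
  calc _ ≤ ((Finset.Ico 1 ⌈bigT D ^ 3⌉₊).card : ℝ) * 1 :=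
        mul_le_mul hsum hexp (Real.exp_pos _).le (Nat.cast_nonneg _)
    _ = _ := mul_one _

/-- `E₁(w,ψ) ≥ 0` (an integral of a nonnegative function). [cite: Zhang2022LandauSiegel, §6 Lemma 6.1 p.30] -/
theorem E1main_nonneg {D : ℕ} (x : Chr D) (w : ℂ) : 0 ≤ E1main x w := by
  unfold E1main
  refine mul_nonneg (by positivity) (intervalIntegral.integral_nonneg ?_ fun v _ => by positivity)
  have : 0 ≤ ell D ^ 20 := by positivity
  linarith

/-- **`Σ_{ψ∈T} E₁(u,ψ)⁴ ≤ C·P²·𝓛³⁶` on the strip `|Re u − ½| ≤ 2α`** (the main part of `E₁`, any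
finite `T ⊆ Ψ`, all large `D`): Hölder in `v` (`(∫_{−𝓛²⁰}^{𝓛²⁰} f)⁴ ≤ (2𝓛²⁰)³∫f⁴`), the sum over `ψ`
inside the integral, and the engine pointwise in `v` (length `(T³)² ≤ P²`, weight `e^{8π}n⁻¹`,
`ω₁ ≤ 1`); prefactor `𝓛⁻²⁷²(2𝓛²⁰)⁴ ≤ 16`.
[cite: Zhang2022LandauSiegel, §8 p.43, tex L2244–2247; §6 Lemma 6.1 p.30] -/
theorem sum_E1main_pow_four_le : ∃ C : ℝ, ∃ D₀ : ℕ, ∀ D : ℕ, D₀ ≤ D →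
    ∀ (T : Finset (Chr D)) (u : ℂ), |u.re - 1 / 2| ≤ 2 * alpha D →
      ∑ x ∈ T, E1main x u ^ 4 ≤ C * bigP D ^ 2 * ell D ^ 36 := by
  obtain ⟨D₁, h₁⟩ := eventually_sizes
  refine ⟨(2 + 2 * (3 + (Real.log 2 ^ 68)⁻¹) ^ 2) * (256 * (Real.exp (8 * π) * majorantConst 4 4)), D₁,
    fun D hD T u hu => ?_⟩
  obtain ⟨hL3, -, hT3, hK2, -⟩ := h₁ D hD
  have hL0 : 0 < ell D := by linarith
  have hL1 : 1 ≤ ell D := by linarith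
  have hu0 : 0 ≤ u.re := by
    have h4 := two_alpha_le_quarter hL3
    have := (abs_le.mp hu).1
    linarith
  have hT0 : 0 ≤ bigT D ^ 3 := by unfold bigT; positivity
  set L : ℝ := ell D ^ 20 with hLdef
  have hL20 : 0 ≤ L := by positivity
  set Nn := ⌈bigT D ^ 3⌉₊ with hNn
  set B : ℝ := (2 + 2 * (3 + (Real.log 2 ^ 68)⁻¹) ^ 2) * bigP D ^ 2 *
    (Real.exp (8 * π) * (majorantConst 4 4 * Real.log (⌊bigP D ^ 2⌋₊ : ℝ) ^ 4)) with hBdef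
  -- the integrand of `E₁(u,ψ)`
  set f : Chr D → ℝ → ℝ := fun x v =>
    ‖∑ n ∈ Finset.Ico 1 Nn, x.ψ (n : ZMod x.p) * (n : ℂ) ^ (-(u + v * I))‖ *
      Real.exp (-(v ^ 2) / (4 * ell D ^ 30)) with hfdef
  have hfc : ∀ x, Continuous (f x) := fun x => continuous_E1integrand x u
  have hf0 : ∀ x v, 0 ≤ f x v := fun x v => by positivity
  have hfM : ∀ x v, f x v ≤ ((Finset.Ico 1 Nn).card : ℝ) := fun x v => E1integrand_le x hu0 v
  -- the engine, pointwise in `v`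
  have hB : ∀ v : ℝ, ∑ x ∈ T, f x v ^ 4 ≤ B := by
    intro v
    have hre : |(u + v * I).re - 1 / 2| ≤ 2 * alpha D := by simpa using hu
    have hmain := sum_norm_psiPoly_pow_four_le T (ceil_sub_one_sq_le hT0 hT3) hK2 (fun _ => (1 : ℂ))
      (B := 1) (fun n => by simp) (u + v * I) (fun k hk => weight_strip hL1 hre k hk)
    simp only [one_mul, max_eq_left (zero_le_one (α := ℝ)), one_pow] at hmain
    refine le_trans (Finset.sum_le_sum fun x _ => ?_) hmain
    have hexp : Real.exp (-(v ^ 2) / (4 * ell D ^ 30)) ≤ 1 := by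
      rw [Real.exp_le_one_iff, neg_div]
      exact neg_nonpos.mpr (by positivity)
    have hS := norm_nonneg (∑ n ∈ Finset.Ico 1 Nn, x.ψ (n : ZMod x.p) * (n : ℂ) ^ (-(u + v * I)))
    calc f x v ^ 4 ≤ (‖∑ n ∈ Finset.Ico 1 Nn, x.ψ (n : ZMod x.p) * (n : ℂ) ^ (-(u + v * I))‖ * 1) ^ 4 := by
          apply pow_le_pow_left₀ (hf0 x v)
          exact mul_le_mul_of_nonneg_left hexp hS
      _ = _ := by rw [mul_one]
  -- Hölder, per `ψ`
  have hH : ∀ x ∈ T, E1main x u ^ 4 ≤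
      (ell D ^ 68)⁻¹ ^ 4 * ((2 * L) ^ 3 * ∫ v in (-L)..L, f x v ^ 4) := by
    intro x _
    have hE : E1main x u = (ell D ^ 68)⁻¹ * ∫ v in (-L)..L, f x v := rfl
    rw [hE, mul_pow]
    exact mul_le_mul_of_nonneg_left (integral_pow_four_le (hfc x) (hf0 x) (hfM x) hL20)
      (by positivity)
  have hfi : ∀ x ∈ T, IntervalIntegrable (fun v => f x v ^ 4) volume (-L) L :=
    fun x _ => ((hfc x).pow 4).intervalIntegrable _ _
  have hLL : -L ≤ L := by linarith
  calc ∑ x ∈ T, E1main x u ^ 4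
      ≤ ∑ x ∈ T, (ell D ^ 68)⁻¹ ^ 4 * ((2 * L) ^ 3 * ∫ v in (-L)..L, f x v ^ 4) :=
        Finset.sum_le_sum hH
    _ = (ell D ^ 68)⁻¹ ^ 4 * ((2 * L) ^ 3 * ∫ v in (-L)..L, ∑ x ∈ T, f x v ^ 4) := by
        rw [intervalIntegral.integral_finsetSum hfi, Finset.mul_sum, Finset.mul_sum]
    _ ≤ (ell D ^ 68)⁻¹ ^ 4 * ((2 * L) ^ 3 * ∫ _ in (-L)..L, B) := by
        apply mul_le_mul_of_nonneg_left _ (by positivity)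
        apply mul_le_mul_of_nonneg_left _ (by positivity)
        exact intervalIntegral.integral_mono_on hLL
          ((continuous_finsetSum T fun x _ => (hfc x).pow 4).intervalIntegrable _ _)
          intervalIntegrable_const (fun v _ => hB v)
    _ = (ell D ^ 68)⁻¹ ^ 4 * (2 * L) ^ 4 * B := by
        rw [intervalIntegral.integral_const, smul_eq_mul]; ring
    _ ≤ 16 * B := by
        have hB0 : 0 ≤ B := by
          rw [hBdef]
          have := (majorantConst_pos 4 4).le
          have hlog : 0 ≤ Real.log (⌊bigP D ^ 2⌋₊ : ℝ) :=
            Real.log_nonneg (by exact_mod_cast (by omega : 1 ≤ ⌊bigP D ^ 2⌋₊))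
          positivity
        apply mul_le_mul_of_nonneg_right _ hB0
        have hℓ : ell D ≠ 0 := hL0.ne'
        have h1 : (ell D ^ 68)⁻¹ ^ 4 * (2 * L) ^ 4 = 16 * (ell D ^ 192)⁻¹ := by
          rw [hLdef]; field_simp; ring
        rw [h1]
        have h2 : (ell D ^ 192)⁻¹ ≤ 1 := inv_le_one_of_one_le₀ (one_le_pow₀ hL1)
        linarith
    _ ≤ _ := by
        rw [hBdef]
        have hlog := log_floor_sq_pow_four_le hK2
        have hmc := (majorantConst_pos 4 4).le
        have he := (Real.exp_pos (8 * π)).le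
        calc 16 * ((2 + 2 * (3 + (Real.log 2 ^ 68)⁻¹) ^ 2) * bigP D ^ 2 *
              (Real.exp (8 * π) * (majorantConst 4 4 * Real.log (⌊bigP D ^ 2⌋₊ : ℝ) ^ 4)))
            ≤ 16 * ((2 + 2 * (3 + (Real.log 2 ^ 68)⁻¹) ^ 2) * bigP D ^ 2 *
              (Real.exp (8 * π) * (majorantConst 4 4 * (16 * ell D ^ 36)))) := by
              apply mul_le_mul_of_nonneg_left _ (by norm_num)
              exact mul_le_mul_of_nonneg_left (mul_le_mul_of_nonneg_left
                (mul_le_mul_of_nonneg_left hlog hmc) he) (by positivity)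
          _ = _ := by ring

end Literature.NumberTheory.LFunctions.Zhang2022.FourthMoments

end
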